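import Mathlib
import Literature.MathematicalPhysics.QuantumFieldTheory.Balaban1983to89.B4Commutators25to211

/-!
# `Balaban1983to89.B4PartitionUnity22` — [Balaban1983RegularityDecay] §2 p. 575: the partition of unity
`{h_j}_{j ∈ Z^d}`, `Σ_j h_j² = 1`, and the cut-offs `θ_j` behind `G₀ = Σ_j h_j G_k(□_j, Ã_j) h_j` (2.2), CONSTRUCTED

statement-level skeleton of published theorems with citation tags; proofs where landed; nothing here is a claim about the Yang–Mills mass gap

CITATION HEADER.  T. Bałaban, *Regularity and decay of lattice Green's functions*, Commun. Math. Phys. **89** (1983)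
571–597, doi:10.1007/bf01214744 [Balaban1983RegularityDecay] (cell paper B4; held text
`paper:balaban1983-cmp89-regularity-decay`, journal page = PDF page + 570; the paragraph was read from the page render
`b2b-balaban-ref1/pages/1983-cmp89-regularity-decay/…-p005-x2.png` (p. 575) and p. 577 (p007)).  Unit `lit-balaban-r01`
gen 5 (B4 fold owner), HOME `run/shared/lean/pub/lit-balaban/`, SKELETON row **B4.Def§2** (before this file: «typed-existing
abstractly … the smooth h, θ are parameters, not constructed» — `B4Commutators25to211` §5 takes the site functions `h j`
and `Σ_j h_j² = 1` as hypotheses, `B4RandomWalk213`/`B4LpChain221` take the labels `j ∈ Z^d`).  The SAME printed object is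
the profile of [Balaban1984PropagatorsI] (1.118) p. 36 («h ∈ C₀^∞(]−⅔, ⅔[), h(t) = 1 for t ∈ [−⅓, ⅓], h is chosen in such a
way that Σ_n h²(t − n) = 1»), for which the tree so far has only the `C^{1,1}` no-plateau torus model `B5SmoothPartition`.

WHAT IS PRINTED (verbatim, p. 575).  *«Next let us define a partition of unity {h_j}_{j∈Z^d} on T_η. For each j ∈ Z^d, we
take h_j(x) = Π_{μ=1}^d h_{j_μ}(x_μ), and functions h_j(x), j ∈ Z, of one real variable x are defined as
h_j(x) = h(x/M − j), h ∈ C₀^∞(]−2/3, 2/3[), h(x) = 1 for x ∈ [−1/3, 1/3], and it is chosen in such a way that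
Σ_{j∈Z} h_j² = 1.»* … *«We take a function θ ∈ C₀^∞(]−1, 1[), θ = 1 on [−3/4, 3/4], and we define
θ_j(x) = Π_{μ=1}^d θ(x_μ/M − j_μ), Ã_j = A₀ + θ_jA′.»*  and p. 577: *«In the sequel we will see that R is a
small operator in reasonable norms because |∂^ηh_j| ≤ O(M⁻¹), |Δ^ηh_j| ≤ O(M⁻²)»*; *«… and the obvious fact that
G_k(□_j, Ã_j)h_jK_{j′}G_k(□_{j′}, Ã_{j′}) = 0, if |j − j′| = max_μ |j_μ − j′_μ| > 1.»*

WHAT THIS MODULE CONSTRUCTS AND PROVES (all `theorem`s sorry-free; axioms standard).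
* §1 the symmetric smooth step `hstep t = Real.smoothTransition (4t − 3/2)` (`0` for `t ≤ 3/8`, `1` for `t ≥ 5/8`,
  `hstep (1 − t) = 1 − hstep t` from `smoothTransition_one_sub`).
* §2 **the profile `h`**: `hprof t = cos(½π·hstep t)·cos(½π·hstep(−t))` — `C^∞` (`contDiff_hprof`), even, `= 1` on
  `|t| ≤ 3/8 ⊇ [−1/3, 1/3]` (`hprof_eq_one`, `hprof_eq_one_third`), `= 0` on `|t| ≥ 5/8` hence on `|t| ≥ 2/3`
  (`hprof_eq_zero`, `hprof_eq_zero_two_thirds`), `0 ≤ h ≤ 1`, compact support `tsupport h ⊆ [−5/8, 5/8] ⊂ ]−2/3, 2/3[`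
  (`tsupport_hprof_subset`, `tsupport_hprof_subset_Ioo`, `hasCompactSupport_hprof`) — i.e. `h ∈ C₀^∞(]−2/3, 2/3[)`
  with the printed plateau.
* §3 **`Σ_{j∈Z} h_j² = 1`**, EXACTLY: on `[0,1]`, `h(t) = cos(½π s)` and `h(t − 1) = sin(½π s)` (`s = hstep t`), so
  `h(t)² + h(t−1)² = 1` (`hprof_sq_add_sq`); only `n ∈ {⌊t⌋, ⌊t⌋+1}` contribute (`hprof_sub_int_eq_zero`); hence
  `Σ_{n∈s} h(t − n)² = 1` for every finite `s ⊇ {n : h(t−n) ≠ 0}` (`sum_hprof_sq`), `Σ_{n=−N}^{N}` for `|t| ≤ N`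
  (`sum_hprof_sq_Icc`), and `HasSum` over `ℤ` (`hasSum_hprof_sq`).
* §4 **the cut-off `θ`**: `thetaProf t = (1 − sT(8t − 6))(1 − sT(−8t − 6))` — `C^∞`, `= 1` on `|t| ≤ 3/4`, `= 0` on
  `|t| ≥ 7/8`, `0 ≤ θ ≤ 1`, `tsupport θ ⊆ [−7/8, 7/8] ⊂ ]−1, 1[`.
* §5 sizes (p. 577 «|∂^ηh_j| ≤ O(M⁻¹), |Δ^ηh_j| ≤ O(M⁻²)»), folklore real analysis: a `C^∞` compactly supported
  `f` has `sup|f′|, sup|f″| < ∞` (`exists_deriv_bounds`); the constants `D1 f = sup|f′|`, `D2 f = sup|f″|`; the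
  mean-value bounds `|f(b) − f(a)| ≤ D1·|b − a|` (`abs_sub_le_D1`) and `|f(t+η) − 2f(t) + f(t−η)| ≤ D2·η²`
  (`abs_second_diff_le_D2`), for `hprof` and `thetaProf`.
* §6 **the `d`-dimensional functions** `hCube M j x = Π_μ h(x_μ/M − j_μ)`, `thetaCube M j x = Π_μ θ(x_μ/M − j_μ)`
  (`ι`-indexed coordinates, `d = card ι`, any `M > 0`): `0 ≤ h_j ≤ 1`; `h_j = 1` on the cube `|x_μ − Mj_μ| ≤ M/3`;
  `h_j(x) ≠ 0 ⇒ |x_μ − Mj_μ| < (5/8)M` for all `μ` (support inside the cube `□_j` of side `2M` centred at `Mj`,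
  `hCube_ne_zero_imp`); **`Σ_{j∈Z^d} h_j(x)² = 1`** for every finite label set containing the support
  (`sum_hCube_sq`, via `Finset.prod_univ_sum`) and as `HasSum` (`hasSum_hCube_sq`); the support geometry
  behind «the obvious fact … = 0, if |j − j′| > 1» (p. 577): if `h_j(x) ≠ 0`, `h_{j′}(y) ≠ 0` and
  `|x_μ − y_μ| ≤ (3/4)M` for all `μ`, then `|j_μ − j′_μ| ≤ 1` for all `μ` (`hCube_labels_adjacent`); `θ_j = 1` on
  `|x_μ − Mj_μ| ≤ (3/4)M`, `= 0` off `|x_μ − Mj_μ| < (7/8)M`.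
* §7 **the finite-difference sizes, uniform in the lattice spacing**: along every axis `μ` and for every step `η`,
  `|h_j(x + ηe_μ) − h_j(x)| ≤ D1(h)·|η|/M` (`abs_hCube_diff_le`: `|∂^ηh_j| ≤ D1/M`) and
  `|h_j(x + ηe_μ) − 2h_j(x) + h_j(x − ηe_μ)| ≤ D2(h)·η²/M²` (`abs_hCube_second_diff_le`), hence
  `|(Δ^ηh_j)(x)| = |Σ_μ η⁻²(…)| ≤ d·D2(h)/M²` (`abs_latticeLaplacian_hCube_le`); the same for `θ_j`, and the
  Leibniz estimate behind «Ã_j = A₀ + θ_jA′ … satisfies the regularity condition (1.4) with another constant c»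
  (`abs_thetaCube_mul_diff_le`: `|θ_jA′(x + ηe_μ) − θ_jA′(x)| ≤ K|η|(1 + D1(θ)/M)` if `|A′| ≤ K`, `|∂A′| ≤ K`).
* §8 the hypothesis `hsum` of `B4Commutators25to211.parametrix_identity` / `green_eq_G0_mul_of_inv` («Σ_j h_j² = 1» as
  `Σ_j mulH(h_j)·mulH(h_j) = 1`) DISCHARGED for the concrete `h_j` restricted to any finite site set `X` with positions
  `pos : X → (ι → ℝ)` (`sum_mulH_hCube_sq_eq_one`).

HONEST SCOPE.  (i) The concrete profile has plateau `[−3/8, 3/8]` and support `[−5/8, 5/8]`; print asks only for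
`h = 1 ⊇ [−1/3,1/3]` and `supp h ⊂ ]−2/3, 2/3[` — both satisfied (strictly).  (ii) The sizes are proved with the
constants `D1 = sup|h′|`, `D2 = sup|h″|` of THIS profile (existence, not a numeral; print: `O(1)`).  (iii) Nothing of the
random-walk expansion (2.12)–(2.13) is asserted here: the cubes `□_j`, the locality (2.6) and the commutator bounds
`‖K_jG_k(□_j,Ã_j)h_j‖ ≤ c₂O(1)M⁻¹` (p. 577) stay where they are (`B4Commutators25to211`, `B4RandomWalk213`,
`B4LpChain221`); this file supplies the two printed real-variable objects those modules take as parameters, with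
every property the text states.  No `Prop` fact; no `sorry`; axioms standard.
-/

namespace Literature.MathematicalPhysics.QuantumFieldTheory.Balaban1983to89.B4PartitionUnity22

open Set Real
open scoped Topology ContDiff

noncomputable section

/-! ## §1. A symmetric smooth step -/

/-- Symmetry of Mathlib's smooth transition: `sT(1 − x) = 1 − sT(x)` (its denominator is symmetric under
`x ↦ 1 − x`). [folklore] -/
private theorem smoothTransition_one_sub (x : ℝ) :
    Real.smoothTransition (1 - x) = 1 - Real.smoothTransition x := by
  unfold Real.smoothTransition
  rw [sub_sub_cancel]
  have h1 := Real.smoothTransition.pos_denom x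
  have h2 : 0 < expNegInvGlue (1 - x) + expNegInvGlue x := by rwa [add_comm]
  field_simp
  ring

/-- The smooth step of the construction: `s(t) = sT(4t − 3/2)` (`0` for `t ≤ 3/8`, `1` for `t ≥ 5/8`).
[cite: Balaban1983RegularityDecay, §2 p.575] -/
def hstep (t : ℝ) : ℝ := Real.smoothTransition (4 * t - 3 / 2)

/-- `s(t) = 0` for `t ≤ 3/8`. [cite: Balaban1983RegularityDecay, §2 p.575] -/
theorem hstep_eq_zero {t : ℝ} (ht : t ≤ 3 / 8) : hstep t = 0 :=
  Real.smoothTransition.zero_of_nonpos (by linarith)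

/-- `s(t) = 1` for `t ≥ 5/8`. [cite: Balaban1983RegularityDecay, §2 p.575] -/
theorem hstep_eq_one {t : ℝ} (ht : 5 / 8 ≤ t) : hstep t = 1 :=
  Real.smoothTransition.one_of_one_le (by linarith)

/-- `0 ≤ s`. [cite: Balaban1983RegularityDecay, §2 p.575] -/
theorem hstep_nonneg (t : ℝ) : 0 ≤ hstep t := Real.smoothTransition.nonneg _

/-- `s ≤ 1`. [cite: Balaban1983RegularityDecay, §2 p.575] -/
theorem hstep_le_one (t : ℝ) : hstep t ≤ 1 := Real.smoothTransition.le_one _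

/-- `s` is monotone. [cite: Balaban1983RegularityDecay, §2 p.575] -/
theorem hstep_monotone : Monotone hstep := fun _ _ hab =>
  Real.smoothTransition.monotone (by linarith)

/-- `s` is `C^n` for every `n ≤ ∞`. [cite: Balaban1983RegularityDecay, §2 p.575] -/
theorem contDiff_hstep {n : ℕ∞} : ContDiff ℝ n hstep :=
  Real.smoothTransition.contDiff.comp ((contDiff_const.mul contDiff_id).sub contDiff_const)

/-- THE SYMMETRY `s(1 − t) = 1 − s(t)` (the step is centred at `t = 1/2`). [cite: Balaban1983RegularityDecay, §2 p.575] -/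
theorem hstep_one_sub (t : ℝ) : hstep (1 - t) = 1 - hstep t := by
  unfold hstep
  rw [show 4 * (1 - t) - 3 / 2 = 1 - (4 * t - 3 / 2) by ring, smoothTransition_one_sub]

/-! ## §2. The profile `h ∈ C₀^∞(]−2/3, 2/3[)`, `h = 1` on `[−1/3, 1/3]` -/

/-- **The profile `h` of p. 575** (a concrete choice): `h(t) = cos(½π·s(t))·cos(½π·s(−t))`.
[cite: Balaban1983RegularityDecay, §2 p.575] -/
def hprof (t : ℝ) : ℝ := Real.cos (π / 2 * hstep t) * Real.cos (π / 2 * hstep (-t))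

/-- `h` is even. [cite: Balaban1983RegularityDecay, §2 p.575] -/
theorem hprof_neg (t : ℝ) : hprof (-t) = hprof t := by
  unfold hprof
  rw [neg_neg, mul_comm]

/-- the cosine factor is in `[0, 1]`: `0 ≤ cos(½π s(u))`. [folklore] -/
private theorem cos_hstep_nonneg (u : ℝ) : 0 ≤ Real.cos (π / 2 * hstep u) := by
  apply Real.cos_nonneg_of_mem_Icc
  constructor
  · have := hstep_nonneg u
    have := Real.pi_pos
    nlinarith
  · have := hstep_le_one u
    have := Real.pi_pos
    nlinarith

/-- for `t ≥ −3/8` the second factor is `1`: `h(t) = cos(½π·s(t))`. [cite: Balaban1983RegularityDecay, §2 p.575] -/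
theorem hprof_of_ge {t : ℝ} (ht : -(3 / 8) ≤ t) : hprof t = Real.cos (π / 2 * hstep t) := by
  unfold hprof
  rw [hstep_eq_zero (by linarith : -t ≤ 3 / 8), mul_zero, Real.cos_zero, mul_one]

/-- for `t ≤ 3/8` the first factor is `1`: `h(t) = cos(½π·s(−t))`. [cite: Balaban1983RegularityDecay, §2 p.575] -/
theorem hprof_of_le {t : ℝ} (ht : t ≤ 3 / 8) : hprof t = Real.cos (π / 2 * hstep (-t)) := by
  unfold hprof
  rw [hstep_eq_zero ht, mul_zero, Real.cos_zero, one_mul]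

/-- `h(t) = 1` for `|t| ≤ 3/8`. [cite: Balaban1983RegularityDecay, §2 p.575] -/
theorem hprof_eq_one {t : ℝ} (ht : |t| ≤ 3 / 8) : hprof t = 1 := by
  obtain ⟨h1, h2⟩ := abs_le.mp ht
  rw [hprof_of_ge (by linarith), hstep_eq_zero h2, mul_zero, Real.cos_zero]

/-- **«h(x) = 1 for x ∈ [−1/3, 1/3]»**. [cite: Balaban1983RegularityDecay, §2 p.575] -/
theorem hprof_eq_one_third {t : ℝ} (ht : |t| ≤ 1 / 3) : hprof t = 1 :=
  hprof_eq_one (ht.trans (by norm_num))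

/-- `h(t) = 0` for `|t| ≥ 5/8`. [cite: Balaban1983RegularityDecay, §2 p.575] -/
theorem hprof_eq_zero {t : ℝ} (ht : 5 / 8 ≤ |t|) : hprof t = 0 := by
  unfold hprof
  rcases le_abs'.mp ht with h | h
  · rw [hstep_eq_one (t := -t) (by linarith), mul_one, Real.cos_pi_div_two, mul_zero]
  · rw [hstep_eq_one h, mul_one, Real.cos_pi_div_two, zero_mul]

/-- **«h ∈ C₀^∞(]−2/3, 2/3[)»**, vanishing: `h(t) = 0` for `|t| ≥ 2/3`. [cite: Balaban1983RegularityDecay, §2 p.575] -/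
theorem hprof_eq_zero_two_thirds {t : ℝ} (ht : 2 / 3 ≤ |t|) : hprof t = 0 :=
  hprof_eq_zero ((by norm_num : (5 : ℝ) / 8 ≤ 2 / 3).trans ht)

/-- `0 ≤ h`. [cite: Balaban1983RegularityDecay, §2 p.575] -/
theorem hprof_nonneg (t : ℝ) : 0 ≤ hprof t :=
  mul_nonneg (cos_hstep_nonneg t) (cos_hstep_nonneg (-t))

/-- `h ≤ 1`. [cite: Balaban1983RegularityDecay, §2 p.575] -/
theorem hprof_le_one (t : ℝ) : hprof t ≤ 1 :=
  mul_le_one₀ (Real.cos_le_one _) (cos_hstep_nonneg (-t)) (Real.cos_le_one _)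

/-- **«h ∈ C₀^∞»**, smoothness: `h` is `C^n` for every `n ≤ ∞`. [cite: Balaban1983RegularityDecay, §2 p.575] -/
theorem contDiff_hprof {n : ℕ∞} : ContDiff ℝ n hprof :=
  (Real.contDiff_cos.comp (contDiff_const.mul contDiff_hstep)).mul
    (Real.contDiff_cos.comp (contDiff_const.mul (contDiff_hstep.comp contDiff_neg)))

/-- `h` is continuous. [cite: Balaban1983RegularityDecay, §2 p.575] -/
theorem continuous_hprof : Continuous hprof := (contDiff_hprof (n := 0)).continuous

/-- `h` is differentiable. [cite: Balaban1983RegularityDecay, §2 p.575] -/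
theorem differentiable_hprof : Differentiable ℝ hprof :=
  (contDiff_hprof (n := 1)).differentiable (by simp)

/-- **«h ∈ C₀^∞(]−2/3, 2/3[)»**, support: `tsupport h ⊆ [−5/8, 5/8]`. [cite: Balaban1983RegularityDecay, §2 p.575] -/
theorem tsupport_hprof_subset : tsupport hprof ⊆ Icc (-(5 / 8)) (5 / 8) := by
  apply closure_minimal _ isClosed_Icc
  intro t ht
  rw [Function.mem_support] at ht
  by_contra h
  apply ht
  apply hprof_eq_zero
  rw [mem_Icc, not_and_or, not_le, not_le] at h
  rcases h with h | h
  · rw [abs_of_neg (by linarith)]; linarith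
  · rw [abs_of_pos (by linarith)]; linarith

/-- **«h ∈ C₀^∞(]−2/3, 2/3[)»**: the support is a compact subset of the OPEN interval `]−2/3, 2/3[`.
[cite: Balaban1983RegularityDecay, §2 p.575] -/
theorem tsupport_hprof_subset_Ioo : tsupport hprof ⊆ Ioo (-(2 / 3)) (2 / 3) :=
  tsupport_hprof_subset.trans (Icc_subset_Ioo (by norm_num) (by norm_num))

/-- **«h ∈ C₀^∞»**, compact support. [cite: Balaban1983RegularityDecay, §2 p.575] -/
theorem hasCompactSupport_hprof : HasCompactSupport hprof :=
  HasCompactSupport.of_support_subset_isCompact isCompact_Icc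
    (subset_tsupport hprof |>.trans tsupport_hprof_subset)

/-! ## §3. `Σ_{j∈Z} h_j² = 1` -/

/-- THE MECHANISM: for `t ∈ [0, 1]`, `h(t) = cos(½π s(t))` and `h(t − 1) = cos(½π s(1 − t)) = sin(½π s(t))`, so
`h(t)² + h(t − 1)² = 1`. [cite: Balaban1983RegularityDecay, §2 p.575] -/
theorem hprof_sq_add_sq {t : ℝ} (h0 : 0 ≤ t) (h1 : t ≤ 1) : hprof t ^ 2 + hprof (t - 1) ^ 2 = 1 := by
  rw [hprof_of_ge (by linarith), hprof_of_le (by linarith), neg_sub, hstep_one_sub, mul_sub, mul_one,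
    Real.cos_pi_div_two_sub, Real.cos_sq_add_sin_sq]

/-- Only the two nearest translates are nonzero: `h(t − n) = 0` unless `n ∈ {⌊t⌋, ⌊t⌋ + 1}`.
[cite: Balaban1983RegularityDecay, §2 p.575] -/
theorem hprof_sub_int_eq_zero {t : ℝ} {n : ℤ} (hn : n ≠ ⌊t⌋ ∧ n ≠ ⌊t⌋ + 1) : hprof (t - n) = 0 := by
  have hfl := Int.floor_le t
  have hlt := Int.lt_floor_add_one t
  apply hprof_eq_zero
  rcases lt_or_gt_of_ne hn.1 with h | h
  · have h' : (n : ℝ) ≤ ⌊t⌋ - 1 := by exact_mod_cast Int.le_sub_one_of_lt h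
    rw [abs_of_pos (by linarith)]
    linarith
  · have h2 : ⌊t⌋ + 1 < n := lt_of_le_of_ne (Int.add_one_le_of_lt h) (Ne.symm hn.2)
    have h3 : ⌊t⌋ + 2 ≤ n := by omega
    have h' : (⌊t⌋ : ℝ) + 2 ≤ n := by exact_mod_cast h3
    rw [abs_of_neg (by linarith)]
    linarith

/-- the two contributing terms: `h(t − ⌊t⌋)² + h(t − ⌊t⌋ − 1)² = 1`. [cite: Balaban1983RegularityDecay, §2 p.575] -/
theorem hprof_sq_floor_add (t : ℝ) : hprof (t - ⌊t⌋) ^ 2 + hprof (t - (⌊t⌋ + 1)) ^ 2 = 1 := by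
  rw [show t - (⌊t⌋ + 1) = t - ⌊t⌋ - 1 by ring]
  exact hprof_sq_add_sq (by linarith [Int.floor_le t]) (by linarith [Int.lt_floor_add_one t])

/-- **«Σ_{j∈Z} h_j² = 1»**: for every finite set `s` of integers containing every `n` with `h(t − n) ≠ 0`,
`Σ_{n∈s} h(t − n)² = 1`. [cite: Balaban1983RegularityDecay, §2 p.575] -/
theorem sum_hprof_sq {t : ℝ} (s : Finset ℤ) (hs : ∀ n : ℤ, hprof (t - n) ≠ 0 → n ∈ s) :
    ∑ n ∈ s, hprof (t - n) ^ 2 = 1 := by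
  classical
  set P : Finset ℤ := {⌊t⌋, ⌊t⌋ + 1} with hP
  have hne : (⌊t⌋ : ℤ) ≠ ⌊t⌋ + 1 := by omega
  have hzero : ∀ n, n ∉ P → hprof (t - n) ^ 2 = 0 := by
    intro n hn
    rw [hP, Finset.mem_insert, Finset.mem_singleton, not_or] at hn
    rw [hprof_sub_int_eq_zero hn, zero_pow two_ne_zero]
  have h1 : ∑ n ∈ s, hprof (t - n) ^ 2 = ∑ n ∈ s ∪ P, hprof (t - n) ^ 2 := by
    apply Finset.sum_subset Finset.subset_union_left
    intro n _ hns
    have : hprof (t - n) = 0 := by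
      by_contra h
      exact hns (hs n h)
    rw [this, zero_pow two_ne_zero]
  have h2 : ∑ n ∈ P, hprof (t - n) ^ 2 = ∑ n ∈ s ∪ P, hprof (t - n) ^ 2 := by
    apply Finset.sum_subset Finset.subset_union_right
    intro n _ hnP
    exact hzero n hnP
  rw [h1, ← h2, hP, Finset.sum_insert (by simp), Finset.sum_singleton]
  push_cast
  exact hprof_sq_floor_add t

/-- **«Σ_{j∈Z} h_j² = 1»**, symmetric-range form: `Σ_{n=−N}^{N} h(t − n)² = 1` for `|t| ≤ N`.
[cite: Balaban1983RegularityDecay, §2 p.575] -/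
theorem sum_hprof_sq_Icc (N : ℕ) {t : ℝ} (ht : |t| ≤ N) :
    ∑ n ∈ Finset.Icc (-(N : ℤ)) N, hprof (t - n) ^ 2 = 1 := by
  apply sum_hprof_sq
  intro n hn
  rw [Finset.mem_Icc]
  by_contra hc
  apply hn
  apply hprof_eq_zero
  obtain ⟨h1, h2⟩ := abs_le.mp ht
  rw [not_and_or, not_le, not_le] at hc
  rcases hc with hc | hc
  · have : (n : ℝ) ≤ -N - 1 := by exact_mod_cast Int.le_sub_one_of_lt hc
    rw [abs_of_pos (by linarith)]
    linarith
  · have : (N : ℝ) + 1 ≤ n := by exact_mod_cast Int.add_one_le_of_lt hc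
    rw [abs_of_neg (by linarith)]
    linarith

/-- **«Σ_{j∈Z} h_j² = 1»** as a sum over all of `ℤ`. [cite: Balaban1983RegularityDecay, §2 p.575] -/
theorem hasSum_hprof_sq (t : ℝ) : HasSum (fun n : ℤ => hprof (t - n) ^ 2) 1 := by
  classical
  have h := sum_hprof_sq (t := t) ({⌊t⌋, ⌊t⌋ + 1} : Finset ℤ) (by
    intro n hn
    rw [Finset.mem_insert, Finset.mem_singleton]
    by_contra hc
    rw [not_or] at hc
    exact hn (hprof_sub_int_eq_zero hc))
  rw [← h]
  apply hasSum_sum_of_ne_finset_zero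
  intro n hn
  rw [Finset.mem_insert, Finset.mem_singleton, not_or] at hn
  rw [hprof_sub_int_eq_zero hn, zero_pow two_ne_zero]

/-! ## §4. The cut-off `θ ∈ C₀^∞(]−1, 1[)`, `θ = 1` on `[−3/4, 3/4]` -/

/-- The step of the cut-off: `sT(8t − 6)` (`0` for `t ≤ 3/4`, `1` for `t ≥ 7/8`).
[cite: Balaban1983RegularityDecay, §2 p.575] -/
def tstep (t : ℝ) : ℝ := Real.smoothTransition (8 * t - 6)

/-- `tstep t = 0` for `t ≤ 3/4`. [cite: Balaban1983RegularityDecay, §2 p.575] -/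
theorem tstep_eq_zero {t : ℝ} (ht : t ≤ 3 / 4) : tstep t = 0 :=
  Real.smoothTransition.zero_of_nonpos (by linarith)

/-- `tstep t = 1` for `t ≥ 7/8`. [cite: Balaban1983RegularityDecay, §2 p.575] -/
theorem tstep_eq_one {t : ℝ} (ht : 7 / 8 ≤ t) : tstep t = 1 :=
  Real.smoothTransition.one_of_one_le (by linarith)

/-- `0 ≤ tstep ≤ 1`. [cite: Balaban1983RegularityDecay, §2 p.575] -/
theorem tstep_mem_Icc (t : ℝ) : tstep t ∈ Icc (0 : ℝ) 1 :=
  ⟨Real.smoothTransition.nonneg _, Real.smoothTransition.le_one _⟩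

/-- `tstep` is `C^n` for every `n ≤ ∞`. [cite: Balaban1983RegularityDecay, §2 p.575] -/
theorem contDiff_tstep {n : ℕ∞} : ContDiff ℝ n tstep :=
  Real.smoothTransition.contDiff.comp ((contDiff_const.mul contDiff_id).sub contDiff_const)

/-- **The cut-off `θ` of p. 575** (a concrete choice): `θ(t) = (1 − sT(8t − 6))(1 − sT(−8t − 6))`.
[cite: Balaban1983RegularityDecay, §2 p.575] -/
def thetaProf (t : ℝ) : ℝ := (1 - tstep t) * (1 - tstep (-t))

/-- `θ` is even. [cite: Balaban1983RegularityDecay, §2 p.575] -/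
theorem thetaProf_neg (t : ℝ) : thetaProf (-t) = thetaProf t := by
  unfold thetaProf
  rw [neg_neg, mul_comm]

/-- **«θ = 1 on [−3/4, 3/4]»**. [cite: Balaban1983RegularityDecay, §2 p.575] -/
theorem thetaProf_eq_one {t : ℝ} (ht : |t| ≤ 3 / 4) : thetaProf t = 1 := by
  obtain ⟨h1, h2⟩ := abs_le.mp ht
  unfold thetaProf
  rw [tstep_eq_zero h2, tstep_eq_zero (by linarith)]
  norm_num

/-- `θ(t) = 0` for `|t| ≥ 7/8`. [cite: Balaban1983RegularityDecay, §2 p.575] -/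
theorem thetaProf_eq_zero {t : ℝ} (ht : 7 / 8 ≤ |t|) : thetaProf t = 0 := by
  unfold thetaProf
  rcases le_abs'.mp ht with h | h
  · rw [tstep_eq_one (t := -t) (by linarith)]; ring
  · rw [tstep_eq_one h]; ring

/-- **«θ ∈ C₀^∞(]−1, 1[)»**, vanishing: `θ(t) = 0` for `|t| ≥ 1`. [cite: Balaban1983RegularityDecay, §2 p.575] -/
theorem thetaProf_eq_zero_one {t : ℝ} (ht : 1 ≤ |t|) : thetaProf t = 0 :=
  thetaProf_eq_zero ((by norm_num : (7 : ℝ) / 8 ≤ 1).trans ht)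

/-- `0 ≤ θ`. [cite: Balaban1983RegularityDecay, §2 p.575] -/
theorem thetaProf_nonneg (t : ℝ) : 0 ≤ thetaProf t :=
  mul_nonneg (by linarith [(tstep_mem_Icc t).2]) (by linarith [(tstep_mem_Icc (-t)).2])

/-- `θ ≤ 1`. [cite: Balaban1983RegularityDecay, §2 p.575] -/
theorem thetaProf_le_one (t : ℝ) : thetaProf t ≤ 1 :=
  mul_le_one₀ (by linarith [(tstep_mem_Icc t).1]) (by linarith [(tstep_mem_Icc (-t)).2])
    (by linarith [(tstep_mem_Icc (-t)).1])

/-- **«θ ∈ C₀^∞»**, smoothness: `θ` is `C^n` for every `n ≤ ∞`. [cite: Balaban1983RegularityDecay, §2 p.575] -/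
theorem contDiff_thetaProf {n : ℕ∞} : ContDiff ℝ n thetaProf :=
  (contDiff_const.sub contDiff_tstep).mul (contDiff_const.sub (contDiff_tstep.comp contDiff_neg))

/-- **«θ ∈ C₀^∞(]−1, 1[)»**, support: `tsupport θ ⊆ [−7/8, 7/8]`. [cite: Balaban1983RegularityDecay, §2 p.575] -/
theorem tsupport_thetaProf_subset : tsupport thetaProf ⊆ Icc (-(7 / 8)) (7 / 8) := by
  apply closure_minimal _ isClosed_Icc
  intro t ht
  rw [Function.mem_support] at ht
  by_contra h
  apply ht
  apply thetaProf_eq_zero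
  rw [mem_Icc, not_and_or, not_le, not_le] at h
  rcases h with h | h
  · rw [abs_of_neg (by linarith)]; linarith
  · rw [abs_of_pos (by linarith)]; linarith

/-- **«θ ∈ C₀^∞(]−1, 1[)»**: the support is a compact subset of the OPEN interval `]−1, 1[`.
[cite: Balaban1983RegularityDecay, §2 p.575] -/
theorem tsupport_thetaProf_subset_Ioo : tsupport thetaProf ⊆ Ioo (-1) 1 :=
  tsupport_thetaProf_subset.trans (Icc_subset_Ioo (by norm_num) (by norm_num))

/-- **«θ ∈ C₀^∞»**, compact support. [cite: Balaban1983RegularityDecay, §2 p.575] -/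
theorem hasCompactSupport_thetaProf : HasCompactSupport thetaProf :=
  HasCompactSupport.of_support_subset_isCompact isCompact_Icc
    (subset_tsupport thetaProf |>.trans tsupport_thetaProf_subset)

/-! ## §5. Sizes: `sup|f′|`, `sup|f″|` of a `C₀^∞` function and the mean-value bounds (folklore real analysis) -/

/-- `D1 f = sup_t |f′(t)|`. [folklore] -/
def D1 (f : ℝ → ℝ) : ℝ := sSup (Set.range fun t => |deriv f t|)

/-- `D2 f = sup_t |f″(t)|`. [folklore] -/
def D2 (f : ℝ → ℝ) : ℝ := sSup (Set.range fun t => |deriv (deriv f) t|)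

/-- a `C^∞` compactly supported function has bounded first and second derivatives — the real-variable content of
«|∂^ηh_j| ≤ O(M⁻¹), |Δ^ηh_j| ≤ O(M⁻²)». [cite: Balaban1983RegularityDecay, §2 p.577] -/
theorem exists_deriv_bounds {f : ℝ → ℝ} (hf : ContDiff ℝ ∞ f) (hs : HasCompactSupport f) :
    (∃ C, ∀ t, |deriv f t| ≤ C) ∧ ∃ C, ∀ t, |deriv (deriv f) t| ≤ C := by
  have hd : ContDiff ℝ ∞ (deriv f) := (contDiff_infty_iff_deriv.mp hf).2
  constructor
  · obtain ⟨C, hC⟩ := (hf.continuous_deriv (by simp)).bounded_above_of_compact_support hs.deriv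
    exact ⟨C, fun t => by simpa [Real.norm_eq_abs] using hC t⟩
  · obtain ⟨C, hC⟩ := (hd.continuous_deriv (by simp)).bounded_above_of_compact_support hs.deriv.deriv
    exact ⟨C, fun t => by simpa [Real.norm_eq_abs] using hC t⟩

/-- `|f′(t)| ≤ D1 f` for a `C₀^∞` function `f`. [cite: Balaban1983RegularityDecay, §2 p.577] -/
theorem abs_deriv_le_D1 {f : ℝ → ℝ} (hf : ContDiff ℝ ∞ f) (hs : HasCompactSupport f) (t : ℝ) :
    |deriv f t| ≤ D1 f := by
  obtain ⟨C, hC⟩ := (exists_deriv_bounds hf hs).1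
  exact le_csSup ⟨C, by rintro _ ⟨u, rfl⟩; exact hC u⟩ ⟨t, rfl⟩

/-- `|f″(t)| ≤ D2 f` for a `C₀^∞` function `f`. [cite: Balaban1983RegularityDecay, §2 p.577] -/
theorem abs_deriv2_le_D2 {f : ℝ → ℝ} (hf : ContDiff ℝ ∞ f) (hs : HasCompactSupport f) (t : ℝ) :
    |deriv (deriv f) t| ≤ D2 f := by
  obtain ⟨C, hC⟩ := (exists_deriv_bounds hf hs).2
  exact le_csSup ⟨C, by rintro _ ⟨u, rfl⟩; exact hC u⟩ ⟨t, rfl⟩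

/-- `0 ≤ D1 f`. [cite: Balaban1983RegularityDecay, §2 p.577] -/
theorem D1_nonneg {f : ℝ → ℝ} (hf : ContDiff ℝ ∞ f) (hs : HasCompactSupport f) : 0 ≤ D1 f :=
  (abs_nonneg _).trans (abs_deriv_le_D1 hf hs 0)

/-- `0 ≤ D2 f`. [cite: Balaban1983RegularityDecay, §2 p.577] -/
theorem D2_nonneg {f : ℝ → ℝ} (hf : ContDiff ℝ ∞ f) (hs : HasCompactSupport f) : 0 ≤ D2 f :=
  (abs_nonneg _).trans (abs_deriv2_le_D2 hf hs 0)

/-- the mean-value bound `|f(b) − f(a)| ≤ sup|f′|·|b − a|` (⇒ «|∂^ηh_j| ≤ O(M⁻¹)»). [cite: Balaban1983RegularityDecay, §2 p.577] -/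
theorem abs_sub_le_D1 {f : ℝ → ℝ} (hf : ContDiff ℝ ∞ f) (hs : HasCompactSupport f) (a b : ℝ) :
    |f b - f a| ≤ D1 f * |b - a| := by
  have hdiff : Differentiable ℝ f := hf.differentiable (by simp)
  have h := Convex.norm_image_sub_le_of_norm_deriv_le (f := f) (s := Set.univ)
    (fun x _ => (hdiff x)) (fun x _ => by rw [Real.norm_eq_abs]; exact abs_deriv_le_D1 hf hs x)
    convex_univ (mem_univ a) (mem_univ b)
  simpa only [Real.norm_eq_abs] using h

/-- the second-difference bound `|f(t + η) − 2f(t) + f(t − η)| ≤ sup|f″|·η²` (mean value theorem twice;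
⇒ «|Δ^ηh_j| ≤ O(M⁻²)»). [cite: Balaban1983RegularityDecay, §2 p.577] -/
theorem abs_second_diff_le_D2 {f : ℝ → ℝ} (hf : ContDiff ℝ ∞ f) (hs : HasCompactSupport f) (t η : ℝ) :
    |f (t + η) - 2 * f t + f (t - η)| ≤ D2 f * η ^ 2 := by
  have hdiff : Differentiable ℝ f := hf.differentiable (by simp)
  have hdiff' : Differentiable ℝ (deriv f) :=
    (contDiff_infty_iff_deriv.mp hf).2.differentiable (by simp)
  -- `g(u) = f(u + η) − f(u)`, `g′(u) = f′(u + η) − f′(u)`, `|g′| ≤ D2·|η|`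
  have hg : ∀ u, HasDerivAt (fun u => f (u + η) - f u) (deriv f (u + η) - deriv f u) u := fun u =>
    ((hdiff (u + η)).hasDerivAt.comp_add_const u η).sub (hdiff u).hasDerivAt
  have hgb : ∀ u, |deriv (fun u => f (u + η) - f u) u| ≤ D2 f * |η| := by
    intro u
    rw [(hg u).deriv]
    have h := Convex.norm_image_sub_le_of_norm_deriv_le (f := deriv f) (s := Set.univ)
      (fun x _ => (hdiff' x)) (fun x _ => by rw [Real.norm_eq_abs]; exact abs_deriv2_le_D2 hf hs x)
      convex_univ (mem_univ u) (mem_univ (u + η))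
    simpa only [Real.norm_eq_abs, add_sub_cancel_left] using h
  have key := Convex.norm_image_sub_le_of_norm_deriv_le (f := fun u => f (u + η) - f u) (s := Set.univ)
    (fun x _ => (hg x).differentiableAt) (fun x _ => by rw [Real.norm_eq_abs]; exact hgb x)
    convex_univ (mem_univ (t - η)) (mem_univ t)
  have hid : f (t + η) - 2 * f t + f (t - η) = (f (t + η) - f t) - (f (t - η + η) - f (t - η)) := by
    rw [sub_add_cancel]; ring
  rw [hid]
  calc |(f (t + η) - f t) - (f (t - η + η) - f (t - η))|
      ≤ D2 f * |η| * ‖t - (t - η)‖ := by simpa only [Real.norm_eq_abs] using key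
    _ = D2 f * η ^ 2 := by rw [Real.norm_eq_abs, sub_sub_cancel, mul_assoc, ← sq, sq_abs]

/-! ## §6. The `d`-dimensional functions `h_j`, `θ_j` (`j ∈ Z^d`, scale `M`) -/

variable {ι : Type*} [Fintype ι]

/-- **`h_j(x) = Π_{μ=1}^d h(x_μ/M − j_μ)`**, `j ∈ Z^d` (coordinates indexed by `ι`, `d = card ι`).
[cite: Balaban1983RegularityDecay, §2 p.575] -/
def hCube (M : ℝ) (j : ι → ℤ) (x : ι → ℝ) : ℝ := ∏ μ, hprof (x μ / M - j μ)

/-- **`θ_j(x) = Π_{μ=1}^d θ(x_μ/M − j_μ)`**. [cite: Balaban1983RegularityDecay, §2 p.575] -/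
def thetaCube (M : ℝ) (j : ι → ℤ) (x : ι → ℝ) : ℝ := ∏ μ, thetaProf (x μ / M - j μ)

/-- the scaled coordinate: `|x_μ/M − j_μ| = |x_μ − Mj_μ|/M`. [folklore] -/
private theorem abs_coord {M : ℝ} (hM : 0 < M) (a : ℝ) (n : ℤ) : |a / M - n| = |a - M * n| / M := by
  rw [← abs_of_pos hM, ← abs_div, abs_of_pos hM, sub_div, mul_div_cancel_left₀ _ hM.ne']

/-- `0 ≤ h_j`. [cite: Balaban1983RegularityDecay, §2 p.575] -/
theorem hCube_nonneg (M : ℝ) (j : ι → ℤ) (x : ι → ℝ) : 0 ≤ hCube M j x :=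
  Finset.prod_nonneg fun _ _ => hprof_nonneg _

/-- `h_j ≤ 1`. [cite: Balaban1983RegularityDecay, §2 p.575] -/
theorem hCube_le_one (M : ℝ) (j : ι → ℤ) (x : ι → ℝ) : hCube M j x ≤ 1 :=
  Finset.prod_le_one (fun _ _ => hprof_nonneg _) fun _ _ => hprof_le_one _

/-- `h_j = 1` on the cube `|x_μ − Mj_μ| ≤ M/3` (all `μ`). [cite: Balaban1983RegularityDecay, §2 p.575] -/
theorem hCube_eq_one {M : ℝ} (hM : 0 < M) {j : ι → ℤ} {x : ι → ℝ} (h : ∀ μ, |x μ - M * j μ| ≤ M / 3) :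
    hCube M j x = 1 := by
  refine Finset.prod_eq_one fun μ _ => hprof_eq_one_third ?_
  rw [abs_coord hM, div_le_iff₀ hM]
  linarith [h μ]

/-- `h_j(x) = 0` as soon as ONE coordinate has `|x_μ − Mj_μ| ≥ (5/8)M`. [cite: Balaban1983RegularityDecay, §2 p.575] -/
theorem hCube_eq_zero {M : ℝ} (hM : 0 < M) {j : ι → ℤ} {x : ι → ℝ} {μ : ι} (h : 5 / 8 * M ≤ |x μ - M * j μ|) :
    hCube M j x = 0 := by
  apply Finset.prod_eq_zero (Finset.mem_univ μ)
  apply hprof_eq_zero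
  rw [abs_coord hM, le_div_iff₀ hM]
  exact h

/-- in particular `h_j(x) = 0` if `|x_μ − Mj_μ| ≥ (2/3)M` for some `μ` (print: `supp h ⊂ ]−2/3, 2/3[`).
[cite: Balaban1983RegularityDecay, §2 p.575] -/
theorem hCube_eq_zero_two_thirds {M : ℝ} (hM : 0 < M) {j : ι → ℤ} {x : ι → ℝ} {μ : ι}
    (h : 2 / 3 * M ≤ |x μ - M * j μ|) : hCube M j x = 0 :=
  hCube_eq_zero hM ((by nlinarith : 5 / 8 * M ≤ 2 / 3 * M).trans h)

/-- SUPPORT: `h_j(x) ≠ 0 ⇒ |x_μ − Mj_μ| < (5/8)M` for every `μ` — `supp h_j` lies inside the cube `□_j` of side `2M`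
centred at `Mj` («□_j is a cube of the size 2M and with center in Mj», p. 575), at distance `≥ (3/8)M` from its
boundary. [cite: Balaban1983RegularityDecay, §2 p.575] -/
theorem hCube_ne_zero_imp {M : ℝ} (hM : 0 < M) {j : ι → ℤ} {x : ι → ℝ} (h : hCube M j x ≠ 0) (μ : ι) :
    |x μ - M * j μ| < 5 / 8 * M := by
  by_contra hc
  exact h (hCube_eq_zero hM (not_lt.mp hc))

/-- the one-dimensional support in integer terms: `h(y − n) ≠ 0 ⇒ n ∈ {⌊y⌋, ⌊y⌋ + 1}`. [cite: Balaban1983RegularityDecay, §2 p.575] -/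
theorem mem_pair_of_hprof_ne_zero {y : ℝ} {n : ℤ} (h : hprof (y - n) ≠ 0) :
    n ∈ ({⌊y⌋, ⌊y⌋ + 1} : Finset ℤ) := by
  rw [Finset.mem_insert, Finset.mem_singleton]
  by_contra hc
  rw [not_or] at hc
  exact h (hprof_sub_int_eq_zero hc)

/-- the labels that can contribute at `x`: `h_j(x) ≠ 0 ⇒ j_μ ∈ {⌊x_μ/M⌋, ⌊x_μ/M⌋ + 1}` for all `μ` (at most `2^d`
labels). [cite: Balaban1983RegularityDecay, §2 p.575] -/
theorem mem_box_of_hCube_ne_zero [DecidableEq ι] {M : ℝ} {j : ι → ℤ} {x : ι → ℝ} (h : hCube M j x ≠ 0) :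
    j ∈ Fintype.piFinset fun μ => ({⌊x μ / M⌋, ⌊x μ / M⌋ + 1} : Finset ℤ) := by
  rw [Fintype.mem_piFinset]
  intro μ
  apply mem_pair_of_hprof_ne_zero
  intro h0
  exact h (Finset.prod_eq_zero (Finset.mem_univ μ) h0)

/-- the sum over the `2^d` candidate labels: `Σ_{j ∈ Π_μ{⌊x_μ/M⌋, ⌊x_μ/M⌋+1}} h_j(x)² = Π_μ (Σ_n h(x_μ/M − n)²) = 1`.
[cite: Balaban1983RegularityDecay, §2 p.575] -/
theorem sum_hCube_sq_box [DecidableEq ι] (M : ℝ) (x : ι → ℝ) :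
    ∑ j ∈ Fintype.piFinset (fun μ => ({⌊x μ / M⌋, ⌊x μ / M⌋ + 1} : Finset ℤ)), hCube M j x ^ 2 = 1 := by
  unfold hCube
  simp_rw [← Finset.prod_pow]
  rw [← Finset.prod_univ_sum (fun μ => ({⌊x μ / M⌋, ⌊x μ / M⌋ + 1} : Finset ℤ))
    (fun μ (n : ℤ) => hprof (x μ / M - n) ^ 2)]
  refine Finset.prod_eq_one fun μ _ => ?_
  exact sum_hprof_sq _ fun n hn => mem_pair_of_hprof_ne_zero hn

/-- **«Σ_{j∈Z^d} h_j² = 1»** (p. 575): for every point `x` and every finite set `s` of labels containing all `j` with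
`h_j(x) ≠ 0`, `Σ_{j∈s} h_j(x)² = 1`. [cite: Balaban1983RegularityDecay, §2 p.575] -/
theorem sum_hCube_sq (M : ℝ) (x : ι → ℝ) (s : Finset (ι → ℤ)) (hs : ∀ j, hCube M j x ≠ 0 → j ∈ s) :
    ∑ j ∈ s, hCube M j x ^ 2 = 1 := by
  classical
  set B := Fintype.piFinset (fun μ => ({⌊x μ / M⌋, ⌊x μ / M⌋ + 1} : Finset ℤ)) with hB
  have hzero : ∀ j, j ∉ B → hCube M j x ^ 2 = 0 := by
    intro j hj
    have : hCube M j x = 0 := by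
      by_contra h
      exact hj (mem_box_of_hCube_ne_zero h)
    rw [this, zero_pow two_ne_zero]
  have h1 : ∑ j ∈ s, hCube M j x ^ 2 = ∑ j ∈ s ∪ B, hCube M j x ^ 2 := by
    apply Finset.sum_subset Finset.subset_union_left
    intro j _ hjs
    have : hCube M j x = 0 := by
      by_contra h
      exact hjs (hs j h)
    rw [this, zero_pow two_ne_zero]
  have h2 : ∑ j ∈ B, hCube M j x ^ 2 = ∑ j ∈ s ∪ B, hCube M j x ^ 2 := by
    apply Finset.sum_subset Finset.subset_union_right
    intro j _ hjB
    exact hzero j hjB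
  rw [h1, ← h2]
  exact sum_hCube_sq_box M x

/-- **«Σ_{j∈Z^d} h_j² = 1»** as a sum over all of `Z^d`. [cite: Balaban1983RegularityDecay, §2 p.575] -/
theorem hasSum_hCube_sq (M : ℝ) (x : ι → ℝ) : HasSum (fun j : ι → ℤ => hCube M j x ^ 2) 1 := by
  classical
  rw [← sum_hCube_sq_box M x]
  apply hasSum_sum_of_ne_finset_zero
  intro j hj
  have : hCube M j x = 0 := by
    by_contra h
    exact hj (mem_box_of_hCube_ne_zero h)
  rw [this, zero_pow two_ne_zero]

/-- THE SUPPORT GEOMETRY behind «the obvious fact that G_k(□_j,Ã_j)h_jK_{j′}G_k(□_{j′},Ã_{j′}) = 0, if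
|j − j′| = max_μ|j_μ − j′_μ| > 1» (p. 577; the walk constraint of (2.13)): two labels whose functions are nonzero at
points within `(3/4)M` of each other in every coordinate (in particular at the same point, or at the two ends of a
lattice bond of length `η ≤ (3/4)M`) are neighbours, `|j_μ − j′_μ| ≤ 1` for all `μ`.
[cite: Balaban1983RegularityDecay, (2.13) p.577] -/
theorem hCube_labels_adjacent {M : ℝ} (hM : 0 < M) {j j' : ι → ℤ} {x y : ι → ℝ} (hj : hCube M j x ≠ 0)
    (hj' : hCube M j' y ≠ 0) (hxy : ∀ μ, |x μ - y μ| ≤ 3 / 4 * M) (μ : ι) : |j μ - j' μ| ≤ 1 := by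
  have h1 := hCube_ne_zero_imp hM hj μ
  have h2 := hCube_ne_zero_imp hM hj' μ
  have h3 := hxy μ
  have hlt : |((j μ : ℤ) : ℝ) - j' μ| < 2 := by
    have key : |M * j μ - M * j' μ| < 2 * M := by
      calc |M * j μ - M * j' μ| = |(M * j μ - x μ) + (x μ - y μ) + (y μ - M * j' μ)| := by ring_nf
        _ ≤ |M * j μ - x μ| + |x μ - y μ| + |y μ - M * j' μ| := abs_add_three _ _ _
        _ < 5 / 8 * M + 3 / 4 * M + 5 / 8 * M := by
            rw [abs_sub_comm (M * j μ) (x μ)]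
            linarith
        _ = 2 * M := by ring
    rw [← mul_sub, abs_mul, abs_of_pos hM] at key
    nlinarith
  have hint : |j μ - j' μ| < 2 := by exact_mod_cast hlt
  omega

/-- `0 ≤ θ_j ≤ 1`. [cite: Balaban1983RegularityDecay, §2 p.575] -/
theorem thetaCube_mem_Icc (M : ℝ) (j : ι → ℤ) (x : ι → ℝ) : thetaCube M j x ∈ Icc (0 : ℝ) 1 :=
  ⟨Finset.prod_nonneg fun _ _ => thetaProf_nonneg _,
    Finset.prod_le_one (fun _ _ => thetaProf_nonneg _) fun _ _ => thetaProf_le_one _⟩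

/-- `θ_j = 1` on the cube `|x_μ − Mj_μ| ≤ (3/4)M` — in particular on «the cube {x : |x − Mj| ≤ ¾M}» where
`Ã_j = A` (p. 575). [cite: Balaban1983RegularityDecay, §2 p.575] -/
theorem thetaCube_eq_one {M : ℝ} (hM : 0 < M) {j : ι → ℤ} {x : ι → ℝ} (h : ∀ μ, |x μ - M * j μ| ≤ 3 / 4 * M) :
    thetaCube M j x = 1 := by
  refine Finset.prod_eq_one fun μ _ => thetaProf_eq_one ?_
  rw [abs_coord hM, div_le_iff₀ hM]
  exact h μ

/-- `θ_j(x) = 0` as soon as one coordinate has `|x_μ − Mj_μ| ≥ (7/8)M` (so `supp θ_j` is inside the open cube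
`|x_μ − Mj_μ| < M`, «a neighbourhood of a boundary of □_j» excluded). [cite: Balaban1983RegularityDecay, §2 p.575] -/
theorem thetaCube_eq_zero {M : ℝ} (hM : 0 < M) {j : ι → ℤ} {x : ι → ℝ} {μ : ι} (h : 7 / 8 * M ≤ |x μ - M * j μ|) :
    thetaCube M j x = 0 := by
  apply Finset.prod_eq_zero (Finset.mem_univ μ)
  apply thetaProf_eq_zero
  rw [abs_coord hM, le_div_iff₀ hM]
  exact h

/-! ## §7. The sizes «|∂^ηh_j| ≤ O(M⁻¹), |Δ^ηh_j| ≤ O(M⁻²)» (p. 577), uniform in the lattice spacing `η` -/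

section Differences

variable [DecidableEq ι]

/-- a product profile at a point moved along the axis `μ`: the `μ`-factor changes, the others do not. [folklore] -/
private theorem prod_update_eq (g : ℝ → ℝ) (M : ℝ) (j : ι → ℤ) (x : ι → ℝ) (μ : ι) (v : ℝ) :
    ∏ ν, g (Function.update x μ v ν / M - j ν)
      = g (v / M - j μ) * ∏ ν ∈ Finset.univ.erase μ, g (x ν / M - j ν) := by
  rw [← Finset.mul_prod_erase Finset.univ _ (Finset.mem_univ μ), Function.update_self]
  congr 1
  refine Finset.prod_congr rfl fun ν hν => ?_
  rw [Function.update_of_ne (Finset.ne_of_mem_erase hν)]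

/-- the same product at the point itself, split at `μ`. [folklore] -/
private theorem prod_split_eq (g : ℝ → ℝ) (M : ℝ) (j : ι → ℤ) (x : ι → ℝ) (μ : ι) :
    ∏ ν, g (x ν / M - j ν) = g (x μ / M - j μ) * ∏ ν ∈ Finset.univ.erase μ, g (x ν / M - j ν) :=
  (Finset.mul_prod_erase Finset.univ _ (Finset.mem_univ μ)).symm

/-- the complementary factor of a `[0,1]`-valued profile is in `[0, 1]`. [folklore] -/
private theorem abs_prod_erase_le_one {g : ℝ → ℝ} (hg0 : ∀ t, 0 ≤ g t) (hg1 : ∀ t, g t ≤ 1) (M : ℝ) (j : ι → ℤ)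
    (x : ι → ℝ) (μ : ι) : |∏ ν ∈ Finset.univ.erase μ, g (x ν / M - j ν)| ≤ 1 := by
  rw [abs_of_nonneg (Finset.prod_nonneg fun _ _ => hg0 _)]
  exact Finset.prod_le_one (fun _ _ => hg0 _) fun _ _ => hg1 _

/-- GENERIC first-difference size for a product profile `Π_μ g(x_μ/M − j_μ)` with `g ∈ C₀^∞`, `0 ≤ g ≤ 1`:
`|Πg(x + ηe_μ) − Πg(x)| ≤ sup|g′|·|η|/M` («|∂^ηh_j| ≤ O(M⁻¹)» for `g = h`, the same for `θ`).
[cite: Balaban1983RegularityDecay, §2 p.577] -/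
theorem abs_prod_diff_le {g : ℝ → ℝ} (hg : ContDiff ℝ ∞ g) (hgs : HasCompactSupport g) (hg0 : ∀ t, 0 ≤ g t)
    (hg1 : ∀ t, g t ≤ 1) {M : ℝ} (hM : 0 < M) (j : ι → ℤ) (x : ι → ℝ) (μ : ι) (η : ℝ) :
    |∏ ν, g (Function.update x μ (x μ + η) ν / M - j ν) - ∏ ν, g (x ν / M - j ν)| ≤ D1 g * |η| / M := by
  rw [prod_update_eq, prod_split_eq g M j x μ, ← sub_mul, abs_mul]
  have hd : |g ((x μ + η) / M - j μ) - g (x μ / M - j μ)| ≤ D1 g * |η| / M := by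
    have h := abs_sub_le_D1 hg hgs (x μ / M - j μ) ((x μ + η) / M - j μ)
    rw [show (x μ + η) / M - (j μ : ℝ) - (x μ / M - j μ) = η / M by ring, abs_div, abs_of_pos hM] at h
    simpa only [mul_div_assoc] using h
  calc |g ((x μ + η) / M - j μ) - g (x μ / M - j μ)| * |∏ ν ∈ Finset.univ.erase μ, g (x ν / M - j ν)|
      ≤ D1 g * |η| / M * 1 :=
        mul_le_mul hd (abs_prod_erase_le_one hg0 hg1 M j x μ) (abs_nonneg _)
          (div_nonneg (mul_nonneg (D1_nonneg hg hgs) (abs_nonneg _)) hM.le)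
    _ = D1 g * |η| / M := mul_one _

/-- GENERIC second-difference size for a product profile:
`|Πg(x + ηe_μ) − 2Πg(x) + Πg(x − ηe_μ)| ≤ sup|g″|·η²/M²` («|Δ^ηh_j| ≤ O(M⁻²)» for `g = h`).
[cite: Balaban1983RegularityDecay, §2 p.577] -/
theorem abs_prod_second_diff_le {g : ℝ → ℝ} (hg : ContDiff ℝ ∞ g) (hgs : HasCompactSupport g)
    (hg0 : ∀ t, 0 ≤ g t) (hg1 : ∀ t, g t ≤ 1) (M : ℝ) (j : ι → ℤ) (x : ι → ℝ) (μ : ι) (η : ℝ) :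
    |∏ ν, g (Function.update x μ (x μ + η) ν / M - j ν) - 2 * ∏ ν, g (x ν / M - j ν)
        + ∏ ν, g (Function.update x μ (x μ - η) ν / M - j ν)| ≤ D2 g * η ^ 2 / M ^ 2 := by
  rw [prod_update_eq, prod_update_eq, prod_split_eq g M j x μ]
  set R := ∏ ν ∈ Finset.univ.erase μ, g (x ν / M - j ν) with hR
  set a := x μ / M - (j μ : ℝ) with ha
  have h1 : (x μ + η) / M - (j μ : ℝ) = a + η / M := by rw [ha]; ring
  have h2 : (x μ - η) / M - (j μ : ℝ) = a - η / M := by rw [ha]; ring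
  rw [h1, h2, show g (a + η / M) * R - 2 * (g a * R) + g (a - η / M) * R
      = (g (a + η / M) - 2 * g a + g (a - η / M)) * R by ring, abs_mul]
  have hd : |g (a + η / M) - 2 * g a + g (a - η / M)| ≤ D2 g * η ^ 2 / M ^ 2 := by
    have h := abs_second_diff_le_D2 hg hgs a (η / M)
    rwa [div_pow, ← mul_div_assoc] at h
  calc |g (a + η / M) - 2 * g a + g (a - η / M)| * |R|
      ≤ D2 g * η ^ 2 / M ^ 2 * 1 :=
        mul_le_mul hd (abs_prod_erase_le_one hg0 hg1 M j x μ) (abs_nonneg _)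
          (div_nonneg (mul_nonneg (D2_nonneg hg hgs) (sq_nonneg _)) (sq_nonneg _))
    _ = D2 g * η ^ 2 / M ^ 2 := mul_one _

/-- **«|∂^ηh_j| ≤ O(M⁻¹)»** (p. 577): along every axis `μ` and for every step `η`,
`|h_j(x + ηe_μ) − h_j(x)| ≤ sup|h′|·|η|/M`, i.e. the lattice derivative `η⁻¹(h_j(x + ηe_μ) − h_j(x))` is bounded by
`D1(h)/M` uniformly in `η`. [cite: Balaban1983RegularityDecay, §2 p.577] -/
theorem abs_hCube_diff_le {M : ℝ} (hM : 0 < M) (j : ι → ℤ) (x : ι → ℝ) (μ : ι) (η : ℝ) :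
    |hCube M j (Function.update x μ (x μ + η)) - hCube M j x| ≤ D1 hprof * |η| / M :=
  abs_prod_diff_le contDiff_hprof hasCompactSupport_hprof hprof_nonneg hprof_le_one hM j x μ η

/-- **«|∂^ηh_j| ≤ O(M⁻¹)»**, lattice-derivative form: `|η⁻¹(h_j(x + ηe_μ) − h_j(x))| ≤ D1(h)/M` (`η ≠ 0`).
[cite: Balaban1983RegularityDecay, §2 p.577] -/
theorem abs_latticeDeriv_hCube_le {M : ℝ} (hM : 0 < M) (j : ι → ℤ) (x : ι → ℝ) (μ : ι) {η : ℝ} (hη : η ≠ 0) :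
    |η⁻¹ * (hCube M j (Function.update x μ (x μ + η)) - hCube M j x)| ≤ D1 hprof / M := by
  rw [abs_mul, abs_inv]
  have h := abs_hCube_diff_le hM j x μ η
  have hη' : 0 < |η| := abs_pos.mpr hη
  rw [← le_div_iff₀' (inv_pos.mpr hη'), div_inv_eq_mul]
  calc |hCube M j (Function.update x μ (x μ + η)) - hCube M j x| ≤ D1 hprof * |η| / M := h
    _ = D1 hprof / M * |η| := by ring

/-- **«|Δ^ηh_j| ≤ O(M⁻²)»** (p. 577), per axis: `|h_j(x + ηe_μ) − 2h_j(x) + h_j(x − ηe_μ)| ≤ sup|h″|·η²/M²`.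
[cite: Balaban1983RegularityDecay, §2 p.577] -/
theorem abs_hCube_second_diff_le (M : ℝ) (j : ι → ℤ) (x : ι → ℝ) (μ : ι) (η : ℝ) :
    |hCube M j (Function.update x μ (x μ + η)) - 2 * hCube M j x + hCube M j (Function.update x μ (x μ - η))|
      ≤ D2 hprof * η ^ 2 / M ^ 2 :=
  abs_prod_second_diff_le contDiff_hprof hasCompactSupport_hprof hprof_nonneg hprof_le_one M j x μ η

/-- **«|Δ^ηh_j| ≤ O(M⁻²)»**, the lattice Laplacian `(Δ^ηh_j)(x) = Σ_μ η⁻²(h_j(x + ηe_μ) − 2h_j(x) + h_j(x − ηe_μ))`: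
`|(Δ^ηh_j)(x)| ≤ d·sup|h″|/M²`, uniformly in `η ≠ 0`. [cite: Balaban1983RegularityDecay, §2 p.577] -/
theorem abs_latticeLaplacian_hCube_le (M : ℝ) (j : ι → ℤ) (x : ι → ℝ) {η : ℝ} (hη : η ≠ 0) :
    |∑ μ, (η ^ 2)⁻¹ * (hCube M j (Function.update x μ (x μ + η)) - 2 * hCube M j x
        + hCube M j (Function.update x μ (x μ - η)))| ≤ Fintype.card ι * (D2 hprof / M ^ 2) := by
  have hη2 : 0 < η ^ 2 := by positivity
  calc |∑ μ, (η ^ 2)⁻¹ * (hCube M j (Function.update x μ (x μ + η)) - 2 * hCube M j x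
          + hCube M j (Function.update x μ (x μ - η)))|
      ≤ ∑ μ, |(η ^ 2)⁻¹ * (hCube M j (Function.update x μ (x μ + η)) - 2 * hCube M j x
          + hCube M j (Function.update x μ (x μ - η)))| := Finset.abs_sum_le_sum_abs _ _
    _ ≤ ∑ _μ : ι, D2 hprof / M ^ 2 := by
        refine Finset.sum_le_sum fun μ _ => ?_
        rw [abs_mul, abs_inv, abs_of_pos hη2, ← div_eq_inv_mul, div_le_iff₀ hη2]
        calc _ ≤ D2 hprof * η ^ 2 / M ^ 2 := abs_hCube_second_diff_le M j x μ η
          _ = D2 hprof / M ^ 2 * η ^ 2 := by ring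
    _ = Fintype.card ι * (D2 hprof / M ^ 2) := by
        rw [Finset.sum_const, Finset.card_univ, nsmul_eq_mul]

/-- the same first-difference size for the cut-offs: `|θ_j(x + ηe_μ) − θ_j(x)| ≤ sup|θ′|·|η|/M` — what «Ã_j = A₀ + θ_jA′
… satisfies the regularity condition (1.4) with another constant c» (p. 575) consumes.
[cite: Balaban1983RegularityDecay, §2 p.575] -/
theorem abs_thetaCube_diff_le {M : ℝ} (hM : 0 < M) (j : ι → ℤ) (x : ι → ℝ) (μ : ι) (η : ℝ) :
    |thetaCube M j (Function.update x μ (x μ + η)) - thetaCube M j x| ≤ D1 thetaProf * |η| / M :=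
  abs_prod_diff_le contDiff_thetaProf hasCompactSupport_thetaProf thetaProf_nonneg thetaProf_le_one hM j x μ η

/-- second-difference size for the cut-offs: `|θ_j(x + ηe_μ) − 2θ_j(x) + θ_j(x − ηe_μ)| ≤ sup|θ″|·η²/M²`.
[cite: Balaban1983RegularityDecay, §2 p.575] -/
theorem abs_thetaCube_second_diff_le (M : ℝ) (j : ι → ℤ) (x : ι → ℝ) (μ : ι) (η : ℝ) :
    |thetaCube M j (Function.update x μ (x μ + η)) - 2 * thetaCube M j x
        + thetaCube M j (Function.update x μ (x μ - η))| ≤ D2 thetaProf * η ^ 2 / M ^ 2 :=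
  abs_prod_second_diff_le contDiff_thetaProf hasCompactSupport_thetaProf thetaProf_nonneg thetaProf_le_one
    M j x μ η

/-- THE REGULARITY OF `Ã_j = A₀ + θ_jA′` («Of course it satisfies the regularity condition (1.4) with another constant
c», p. 575), as the Leibniz estimate it amounts to: if `|A′| ≤ K` and `|A′(x + ηe_μ) − A′(x)| ≤ K|η|` (A′ «regular and
small») then `|θ_j(x + ηe_μ)A′(x + ηe_μ) − θ_j(x)A′(x)| ≤ K|η|(1 + sup|θ′|/M)` — the constant part `A₀` drops out of
every difference. [cite: Balaban1983RegularityDecay, §2 p.575] -/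
theorem abs_thetaCube_mul_diff_le {M : ℝ} (hM : 0 < M) (j : ι → ℤ) (x : ι → ℝ) (μ : ι) (η : ℝ)
    (A' : (ι → ℝ) → ℝ) {K : ℝ} (hK : ∀ y, |A' y| ≤ K)
    (hreg : |A' (Function.update x μ (x μ + η)) - A' x| ≤ K * |η|) :
    |thetaCube M j (Function.update x μ (x μ + η)) * A' (Function.update x μ (x μ + η)) - thetaCube M j x * A' x|
      ≤ K * |η| * (1 + D1 thetaProf / M) := by
  set y := Function.update x μ (x μ + η) with hy
  have hθy := thetaCube_mem_Icc M j y
  have hsplit : thetaCube M j y * A' y - thetaCube M j x * A' x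
      = thetaCube M j y * (A' y - A' x) + (thetaCube M j y - thetaCube M j x) * A' x := by ring
  rw [hsplit]
  calc |thetaCube M j y * (A' y - A' x) + (thetaCube M j y - thetaCube M j x) * A' x|
      ≤ |thetaCube M j y * (A' y - A' x)| + |(thetaCube M j y - thetaCube M j x) * A' x| := abs_add_le _ _
    _ = |thetaCube M j y| * |A' y - A' x| + |thetaCube M j y - thetaCube M j x| * |A' x| := by
        rw [abs_mul, abs_mul]
    _ ≤ 1 * (K * |η|) + D1 thetaProf * |η| / M * K := by
        refine add_le_add (mul_le_mul ?_ hreg (abs_nonneg _) zero_le_one)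
          (mul_le_mul (abs_thetaCube_diff_le hM j x μ η) (hK x) (abs_nonneg _)
            (div_nonneg (mul_nonneg (D1_nonneg contDiff_thetaProf hasCompactSupport_thetaProf) (abs_nonneg _))
              hM.le))
        rw [abs_of_nonneg hθy.1]
        exact hθy.2
    _ = K * |η| * (1 + D1 thetaProf / M) := by ring

end Differences

/-! ## §8. The hypothesis «Σ_j h_j² = 1» of the parametrix identity (2.9)–(2.12) DISCHARGED for the concrete `h_j` -/

open B4Commutators25to211 in
/-- For any finite site set `X` with positions `pos : X → ℝ^d` (e.g. the sites of `Ω ⊂ ηZ^d` or of `T_η`) and any finite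
label set `s ⊇ {j : h_j ≠ 0 on X}`, the multiplication operators of the concrete `h_j` satisfy
`Σ_{j∈s} mulH(h_j)·mulH(h_j) = 1` — the hypothesis `hsum` of `B4Commutators25to211.parametrix_identity` /
`green_eq_G0_mul_of_inv` ((2.9) ⇒ (2.11) ⇒ (2.12)). [cite: Balaban1983RegularityDecay, (2.2) p.575] -/
theorem sum_mulH_hCube_sq_eq_one {X κ : Type*} [Fintype X] [DecidableEq X] [Fintype κ] [DecidableEq κ]
    (M : ℝ) (pos : X → ι → ℝ) (s : Finset (ι → ℤ)) (hs : ∀ j x, hCube M j (pos x) ≠ 0 → j ∈ s) :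
    ∑ j ∈ s, mulH (ι := κ) (fun x => hCube M j (pos x)) * mulH (ι := κ) (fun x => hCube M j (pos x)) = 1 :=
  sum_mulH_sq_eq_one s _ fun x => sum_hCube_sq M (pos x) s fun j hj => hs j x hj

end

end Literature.MathematicalPhysics.QuantumFieldTheory.Balaban1983to89.B4PartitionUnity22
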